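import Summits.Ventures.Crystal3D.Theorems.StickyWulffConstantTextureLiminfFluxZigzagSel
import HarnessLib

/-!
# Slot-hood ⇒ `IsUpBond`: the two entry points for lane G's walk machine (Δ slot, ∇ mirrored capper)
# (lane T, flux count — interface with lane G's F4; crux `TextureLiminf`, stmt-Ventures-19483)

HONEST FRAMING. Venture `Summits/Ventures/Crystal3D` (cell `crystal3d-full`), helper `--supports` the crux
`TextureLiminf` (stmt-Ventures-19483) of `route-Ventures-StickyWulffConstant`, registered line `TexShadow` (v6.7; cf-p1
ROUTE.md §86(61) BD).  Rung credit only; F-C1 not moved.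

F4 (19480-p2) instantiates `IsZigSelector` (`…FluxZigzagSel`) with the machine's steps: on a Δ-bilayer (`σ i = 1`) an fcc
slot `q` of positive model height, on a ∇-bilayer (`σ i = −1`) the basal mirror image of a slot of negative model height
(`basalMirror (bestCapper …)`), each times `axisSign`.  This file proves that these ARE upward bonds in the normal form of
`IsUpBond`:

* `neg_barlowPos_neg_one` (`haggLabel_const`) — `−barlowPos … constHagg (−1) a b = barlowPos … constHagg 1 (−a) (−b)`;
* **`isUpBond_of_upperSlot`** — `q ∈ fccSlots`, `0 < q 2`, `σ i = 1` ⇒ `IsUpBond L σ e i (axisSign L e • q)`;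
* **`isUpBond_of_lowerSlot`** — `q ∈ fccSlots`, `q 2 < 0`, `σ i ≠ 1` ⇒ `IsUpBond L σ e i (axisSign L e • basalMirror q)`.
So F4's selector obligations reduce to slot-hood + sign of the model height + the rise equality.
WHAT THIS IS NOT: not F4; F-C1 not moved.
-/

noncomputable section

namespace Summit.Ventures.Crystal3D.Theorems

open Literature.MathematicalPhysics.StatisticalMechanics (barlowPos constHagg basalMirror barlowPos_apply_two)
open Summit.Ventures.Crystal3D.Cruxes.TextureLiminf.TexShadow (E3)

/-- **A lower fcc slot is minus an upper one:** `−barlowPos … (−1) a b = barlowPos … 1 (−a) (−b)` (constant Hägg word). -/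
theorem neg_barlowPos_neg_one (a b : ℤ) :
    -barlowPos 1 (Real.sqrt (2 / 3)) constHagg (-1) a b = barlowPos 1 (Real.sqrt (2 / 3)) constHagg 1 (-a) (-b) := by
  ext l
  fin_cases l
  · simp; ring
  · simp; ring
  · simp [barlowPos_apply_two]

/-- The model height of the slot with triple `t`. -/
theorem slotTriple_apply_two (t : ℤ × ℤ × ℤ) :
    barlowPos 1 (Real.sqrt (2 / 3)) constHagg t.1 t.2.1 t.2.2 2 = t.1 * Real.sqrt (2 / 3) := barlowPos_apply_two _ _ _ _ _ _

/-- **Δ entry point:** an fcc slot of positive model height, times `axisSign`, is an upward bond of a Δ-bilayer. -/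
theorem isUpBond_of_upperSlot (L : E3 ≃ₗᵢ[ℝ] E3) {σ : ℤ → ℤ} (e : E3) {i : ℤ} (hσi : σ i = 1)
    {q : E3} (hq : q ∈ fccSlots) (hq2 : 0 < q 2) : IsUpBond L σ e i (axisSign L e • q) := by
  have hB : 0 < Real.sqrt (2 / 3) := Real.sqrt_pos.2 (by norm_num)
  rw [fccSlots, Finset.mem_image] at hq
  obtain ⟨t, ht, rfl⟩ := hq
  rw [slotTriple_apply_two] at hq2
  have ht1 : t.1 = 1 := by
    simp only [fccSlotTriples, Finset.mem_insert, Finset.mem_singleton] at ht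
    rcases ht with rfl | rfl | rfl | rfl | rfl | rfl | rfl | rfl | rfl | rfl | rfl | rfl
    all_goals try rfl
    all_goals exfalso; push_cast at hq2; nlinarith [hB]
  refine ⟨t.2.1, t.2.2, ?_, ?_⟩
  · simp only [fccSlotTriples, Finset.mem_insert, Finset.mem_singleton] at ht
    rcases ht with rfl | rfl | rfl | rfl | rfl | rfl | rfl | rfl | rfl | rfl | rfl | rfl <;> simp_all
  · rw [if_pos hσi, ← ht1]

/-- **∇ entry point:** the basal mirror image of an fcc slot of negative model height, times `axisSign`, is an upward
bond of a ∇-bilayer. -/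
theorem isUpBond_of_lowerSlot (L : E3 ≃ₗᵢ[ℝ] E3) {σ : ℤ → ℤ} (e : E3) {i : ℤ} (hσi : σ i ≠ 1)
    {q : E3} (hq : q ∈ fccSlots) (hq2 : q 2 < 0) : IsUpBond L σ e i (axisSign L e • basalMirror q) := by
  have hB : 0 < Real.sqrt (2 / 3) := Real.sqrt_pos.2 (by norm_num)
  rw [fccSlots, Finset.mem_image] at hq
  obtain ⟨t, ht, rfl⟩ := hq
  rw [slotTriple_apply_two] at hq2
  have ht1 : t.1 = -1 := by
    simp only [fccSlotTriples, Finset.mem_insert, Finset.mem_singleton] at ht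
    rcases ht with rfl | rfl | rfl | rfl | rfl | rfl | rfl | rfl | rfl | rfl | rfl | rfl
    all_goals try rfl
    all_goals exfalso; push_cast at hq2; nlinarith [hB]
  refine ⟨-t.2.1, -t.2.2, ?_, ?_⟩
  · simp only [fccSlotTriples, Finset.mem_insert, Finset.mem_singleton] at ht
    rcases ht with rfl | rfl | rfl | rfl | rfl | rfl | rfl | rfl | rfl | rfl | rfl | rfl <;> simp_all
  · rw [if_neg hσi, ← neg_barlowPos_neg_one]; simp only [neg_neg, ht1]

end Summit.Ventures.Crystal3D.Theorems

end
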